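import Summits.QuantumFields.GaugeBoot.StrongCouplingPlaquetteLimit
import Summits.QuantumFields.GaugeBoot.HaarShiftUniqueness
import HarnessLib

/-!
# Strong coupling from the loop equation, IX: second order for EVERY DLR state in the uniqueness window (gauge-boot, ADDENDUM 22 part I)

HONEST FRAMING (cell `pub-gaugeboot`, page 1 of every file): the venture produces certified bounds
on lattice expectations at stated coupling, gauge group, dimension and torus size; NOT a mass gap,
NOT a continuum limit, NOT a string tension; NOT Yang–Mills-summit-bearing (barriers
`FixedCouplingUltralocality`, `PerturbativeInvisibility`).  Analytic STRONG-COUPLING statements in the Dobrushin uniqueness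
window only; no number of CERTIFIED.md is touched.

## Content (`SU(N)`, fundamental representation, `ℤ^D`, `D ≥ 2`, standard coupling `β_std` with `6(D−1)|β_std| < 1`)

In the tree's Dobrushin window `6(d−1)N|β| < 1` (tree coupling `β = β_std/N`) every Haar-shift / DLR state on `ℤ^D` IS an
infinite-volume limit point of the torus Wilson states (`IsHaarShiftState.mem_infiniteVolumeLimitPoints_of_small`,
`HaarShiftUniqueness`), so the limit-point bounds of `StrongCouplingPlaquetteLimit` hold for every DLR state there — and the
window `|β_std| < 1/(6(D−1))` contains the whole range in which the second-order bounds are informative: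

* ★★★ `abs_integral_plaquette_sub_le_of_mem_ymGibbsMeasures` — `N ≥ 3`, `6(D−1)|β_std| < 1`, EVERY `μ ∈ 𝒢(β_std/N)`, every
  plaquette: `|∫ (1/N)Re tr U_P dμ − β_std/(2N²)| ≤ C(N,D)·β_std²`; `SU(3)`, `D = 4` (`|β| < 1/18`): `|∫⅓Re tr U_P dμ − β/18| ≤ 79β²/30`;
* ★★★ `abs_integral_plaquette_sub_le_of_mem_ymGibbsMeasures_two` — `SU(2)`: `|∫ ½Re tr U_P dμ − β_std/4| ≤ ((D−1)(16D−21)/9)β_std²`.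

(The FIRST-order bound holds for every DLR state at EVERY coupling: `StrongCouplingPlaquetteDLR`.)  Everything is `[folklore]`.
-/

noncomputable section

open MeasureTheory
open Literature.MathematicalPhysics.QuantumLattice (LGConfig plaquetteObs ymGibbsMeasures ymSpecification infiniteVolumeLimitPoints)
open Literature.Probability.LatticeModels (IsGibbsMeasure)

namespace Summit.QuantumFields.GaugeBoot

namespace StrongCoupling

/-- In the Dobrushin window `6(D−1)|β_std| < 1` every DLR state of `SU(N)` at standard coupling `β_std` is an infinite-volume
limit point of the torus Wilson states (tree: Haar-shift uniqueness). [folklore] -/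
theorem mem_limitPoints_of_mem_ymGibbsMeasures_of_small {N D : ℕ} (hN : 1 ≤ N) (hD : 1 ≤ D) {β : ℝ}
    (hβ : 6 * ((D : ℝ) - 1) * |β| < 1) {μ : Measure (LGConfig D (SU N))}
    (hμ : μ ∈ ymGibbsMeasures (d := D) (suRep N) (β / N)) : μ ∈ infiniteVolumeLimitPoints (d := D) (suRep N) (β / N) := by
  haveI : SecondCountableTopology (Matrix (Fin N) (Fin N) ℂ) := inferInstanceAs (SecondCountableTopology (Fin N → Fin N → ℂ))
  haveI : SecondCountableTopology (SU N) := Topology.IsEmbedding.subtypeVal.secondCountableTopology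
  have hG : IsGibbsMeasure (ymSpecification (suRep N) (β / N)) μ := hμ
  haveI := hG.isProbabilityMeasure
  have hNpos : (0 : ℝ) < N := by exact_mod_cast hN
  have hD1 : ((D - 1 : ℕ) : ℝ) ≤ (D : ℝ) - 1 := by rw [Nat.cast_sub hD, Nat.cast_one]
  have hβ' : 6 * ((D - 1 : ℕ) : ℝ) * N * |β / N| < 1 := by
    rw [abs_div, Nat.abs_cast]
    calc 6 * ((D - 1 : ℕ) : ℝ) * N * (|β| / N) = 6 * ((D - 1 : ℕ) : ℝ) * |β| := by field_simp
      _ ≤ 6 * ((D : ℝ) - 1) * |β| := by gcongr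
      _ < 1 := hβ
  exact (isHaarShiftState_of_mem_ymGibbsMeasures (suRep N) (continuous_suRep N) hμ).mem_infiniteVolumeLimitPoints_of_small
    (suRep N) (continuous_suRep N) hβ'

/-- ★★★ **Second order for every DLR state in the uniqueness window, `N ≥ 3`.**  For `D ≥ 2`, `6(D−1)|β_std| < 1`, every
`μ ∈ 𝒢(β_std/N)` on `ℤ^D` and every plaquette `(x; i ≠ j)`:
`|∫ (1/N)Re tr U_P dμ − β_std/(2N²)| ≤ (2(D−1)β_std²/(N²(N²−1)))·(1 + 4N⁴/((N²−1)(N²−4)) + 4(2D−3)N²/(N²−1))`. [folklore] -/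
theorem abs_integral_plaquette_sub_le_of_mem_ymGibbsMeasures {N D : ℕ} (hN : 3 ≤ N) (hD : 2 ≤ D) {β : ℝ}
    (hβ : 6 * ((D : ℝ) - 1) * |β| < 1) {μ : Measure (LGConfig D (SU N))}
    (hμ : μ ∈ ymGibbsMeasures (d := D) (suRep N) (β / N)) (x : Literature.Probability.LatticeModels.Site D) {i j : Fin D}
    (hij : i ≠ j) :
    |∫ U, (N : ℝ)⁻¹ * plaquetteObs (suRep N) x i j U ∂μ - β / (2 * (N : ℝ) ^ 2)| ≤
      2 * ((D : ℝ) - 1) * β ^ 2 / ((N : ℝ) ^ 2 * ((N : ℝ) ^ 2 - 1)) *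
        (1 + 4 * (N : ℝ) ^ 4 / (((N : ℝ) ^ 2 - 1) * ((N : ℝ) ^ 2 - 4)) + 4 * (2 * (D : ℝ) - 3) * (N : ℝ) ^ 2 / ((N : ℝ) ^ 2 - 1)) :=
  abs_integral_plaquette_sub_le_of_mem_limitPoints hN hD β (mem_limitPoints_of_mem_ymGibbsMeasures_of_small (by omega) (by omega) hβ hμ) x hij

/-- `SU(3)`, `D = 4`, `|β_std| < 1/18`, every DLR state: `|∫⅓Re tr U_P dμ − β_std/18| ≤ 79β_std²/30`. [folklore] -/
theorem abs_integral_plaquette_sub_le_of_mem_ymGibbsMeasures_three_four {β : ℝ} (hβ : 18 * |β| < 1)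
    {μ : Measure (LGConfig 4 (SU 3))} (hμ : μ ∈ ymGibbsMeasures (d := 4) (suRep 3) (β / 3))
    (x : Literature.Probability.LatticeModels.Site 4) {i j : Fin 4} (hij : i ≠ j) :
    |∫ U, (3 : ℝ)⁻¹ * plaquetteObs (suRep 3) x i j U ∂μ - β / 18| ≤ 79 * β ^ 2 / 30 :=
  abs_integral_plaquette_sub_le_of_mem_limitPoints_three_four β
    (by simpa using mem_limitPoints_of_mem_ymGibbsMeasures_of_small (N := 3) (D := 4) (by norm_num) (by norm_num) (by norm_num; linarith) hμ) x hij

/-- ★★★ **Second order for every DLR state in the uniqueness window, `SU(2)`**: for `D ≥ 2`, `6(D−1)|β_std| < 1`, every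
`μ ∈ 𝒢(β_std/2)` and every plaquette: `|∫ ½Re tr U_P dμ − β_std/4| ≤ ((D−1)(16D−21)/9)·β_std²`. [folklore] -/
theorem abs_integral_plaquette_sub_le_of_mem_ymGibbsMeasures_two {D : ℕ} (hD : 2 ≤ D) {β : ℝ}
    (hβ : 6 * ((D : ℝ) - 1) * |β| < 1) {μ : Measure (LGConfig D (SU 2))} (hμ : μ ∈ ymGibbsMeasures (d := D) (suRep 2) (β / 2))
    (x : Literature.Probability.LatticeModels.Site D) {i j : Fin D} (hij : i ≠ j) :
    |∫ U, (2 : ℝ)⁻¹ * plaquetteObs (suRep 2) x i j U ∂μ - β / 4| ≤ ((D : ℝ) - 1) * (16 * (D : ℝ) - 21) / 9 * β ^ 2 :=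
  abs_integral_plaquette_sub_le_of_mem_limitPoints_two hD β
    (by simpa using mem_limitPoints_of_mem_ymGibbsMeasures_of_small (N := 2) (D := D) (by norm_num) (by omega) hβ hμ) x hij

end StrongCoupling

end Summit.QuantumFields.GaugeBoot

end
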